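/-
Copyright (c) 2026. All rights reserved.
Released under Apache 2.0 license as described in the file LICENSE.
Authors: HodgeCM publication cell (pub-hodgecm), GR lane, seat GR-2 (`pub-hodgecm-own-hyp34`).
-/
import Literature.NumberTheory.GelbartRogawski1991.Prop311AsPrinted
import Literature.NumberTheory.Automorphic.HilbertRepSchur
import Literature.RepresentationTheory.HeisenbergGroup.SymplecticGroupPerfect
import Mathlib.RingTheory.Trace.Basic
import HarnessLib

/-!
# [GelbartRogawski1991, §3.1]: in the PRINTED setting of Prop. 3.1.1, the splitting `i` over `Sp_F(W)` is unique

Topic `NumberTheory/GelbartRogawski1991`; namespace `Literature.NumberTheory.GelbartRogawski1991.Prop311` (the namespace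
of the auxiliary objects of the statement-exact typing `Prop311AsPrinted`).  KERNEL only: theorems; no definition, no
named fact, no `axiom`, no proof hole; `Prop311AsPrinted` itself is untouched (nothing of it is assumed or asserted).

[GelbartRogawski1991, §3.1 p. 454 L35–36] (verbatim): "*It is known ([We]) that `π` splits uniquely over the group of
`F`-rational points `Sp_F(W)`. We denote this splitting by `i`.*"  The statement-exact typing `Prop311AsPrinted`
(rendering R3) quantifies over a homomorphism `i : Sp_F(W) →* Mp_𝐀(W)` with two hypothesis binders: `_hi`, "`i` is a
splitting of `π` over `Sp_F(W) ⊆ Sp_𝐀(W)`" (`IsRationalSplitting`), and `_hi!`, "`i` is THE unique such"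
(`∀ i′, IsRationalSplitting i′ → i′ = i`).  This file PROVES that, in the printed setting, `_hi!` FOLLOWS from `_hi`:
for the printed objects — `E/F` with the conjugation `σ`, a skew-Hermitian space `(V, Φ)` ("`Φ y x = -σ(Φ x y)`") with
`φ = Tr_{E/F} Φ` non-degenerate, `V` finite-dimensional, and `Mp_𝐀(W)` the group of pairs `(g, M_g)` over an
IRREDUCIBLE UNITARY `ρ_ψ` on a Hilbert space (renderings R4–R8) — any two splittings of `π` over `Sp_F(W)` coincide
(`rationalSplitting_unique`).  The two inputs:

* `ker π ≤ center Mp_𝐀(W)` (`ker_proj_le_center`): a pair `(1, M)` has `M` bounded, commuting with every `ρ_ψ(h)`;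
  the operators `ρ_ψ(h)` are unitary, so the family is self-adjoint and — `ρ_ψ` being irreducible — Schur's lemma
  (the tree's `Literature.NumberTheory.Automorphic.IsIrreducibleFamily.exists_eq_algebraMap`, [DeitmarEchterhoff2014,
  Thm. 5.1.6]) makes `M` a scalar, hence `(1, M)` central (`exists_op_eq_smul_of_proj_eq_one`,
  `mem_center_of_proj_eq_one`) — this is the middle exactness of the printed
  "`0 ⟶ ℂ* ⟶ Mp_𝐀(W) ⟶π Sp_𝐀(W) ⟶ 0`" (p. 454 L26–27) for the printed model;
* `Sp_F(W) = ratSp F E V Φ` (the isometry group of the symplectic `F`-space `(W, φ)`) has no non-trivial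
  homomorphism to a commutative group (`HeisenbergGroup.SymplecticGroupPerfect`, `char F = 0`), so two lifts
  through the central-kernel `π` agree (`Heisenberg.PseudoSymplectic.eq_of_comp_eq_of_ker_le_center`).

Also recorded: the trace form of a skew-Hermitian form is alternating (`isAlt_traceForm`, from `Tr ∘ σ = Tr`), and
`W = V|_F` is finite-dimensional over `F` when `V` is over `E` (`finite_restrictScalars`).  Reading for the
statement-exact typing: the binder `_hi!` of `Prop311AsPrinted` is REDUNDANT given `_hi` (harmless: the typing stays
as printed); a consumer instantiating `Prop311AsPrinted` discharges `_hi!` by `rationalSplitting_unique`.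

## References
* [GelbartRogawski1991] S. Gelbart, J. Rogawski, Invent. Math. 105 (1991), §3.1 p. 454 L17–42, Prop. 3.1.1 p. 455 L1–3.
* [DeitmarEchterhoff2014] A. Deitmar, S. Echterhoff, *Principles of Harmonic Analysis*, 2nd ed. (2014), Thm. 5.1.6,
  Lemma 6.1.7 (Schur's lemma for unitary representations).
* [MoeglinVignerasWaldspurger1987] C. Mœglin, M.-F. Vignéras, J.-L. Waldspurger, LNM 1291 (1987), Chap. 2 II.1 (B)
  ("`M` est unique à un scalaire près"; the sequence `1 → ℂˣ → S̃p_ψ(W) → Sp(W) → 1`).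
-/

set_option autoImplicit false

noncomputable section

open NumberField
open scoped TensorProduct

namespace Literature.NumberTheory.GelbartRogawski1991

namespace Prop311

open Literature.RepresentationTheory.HeisenbergGroup Literature.NumberTheory.Automorphic

variable (F : Type) [Field F] [NumberField F]
variable (E : Type) [Field E] [Algebra F E]
variable (V : Type) [AddCommGroup V] [Module F V]
variable (Φ : V →ₗ[F] V →ₗ[F] E)

/-! ## §1 The printed linear algebra: `φ = Tr_{E/F} Φ` is alternating; `W` is finite-dimensional over `F` -/

omit [NumberField F] in
/-- **the trace form of a skew-Hermitian form is alternating**: "`Φ y x = -σ(Φ x y)`" (applied at `y = x`) and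
`Tr_{E/F} ∘ σ = Tr_{E/F}` give `2 · Tr Φ(x, x) = 0`. (`F` of characteristic `0`.)
[cite: GelbartRogawski1991, §3.1 p. 454 L17, L37–42] -/
theorem isAlt_traceForm [CharZero F] (σ : E ≃ₐ[F] E) (hΦ₃ : ∀ x y : V, Φ y x = -σ (Φ x y)) :
    (traceForm F E V Φ).IsAlt := by
  intro x
  change traceForm F E V Φ x x = 0
  rw [traceForm_apply]
  have h : Algebra.trace F E (Φ x x) = -Algebra.trace F E (Φ x x) := by
    conv_lhs => rw [hΦ₃ x x]
    rw [map_neg, Algebra.trace_eq_of_algEquiv]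
  have h2 : Algebra.trace F E (Φ x x) + Algebra.trace F E (Φ x x) = 0 := by
    nth_rewrite 2 [h]
    exact add_neg_cancel _
  exact add_self_eq_zero.1 h2

omit [NumberField F] in
/-- "`W` coincides with `V`, but viewed as an `F`-vector space": `W` is finite-dimensional over `F` when `V` is
finite-dimensional over the quadratic extension `E`. [cite: GelbartRogawski1991, §3.1 p. 454 L37–42] -/
theorem finite_restrictScalars [Module E V] [IsScalarTower F E V] [Algebra.IsQuadraticExtension F E]
    [FiniteDimensional E V] : FiniteDimensional F V :=
  haveI : Module.Finite F E := Module.finite_of_finrank_eq_succ (Algebra.IsQuadraticExtension.finrank_eq_two F E)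
  Module.Finite.trans E V

/-! ## §2 The printed `Mp_𝐀(W)`: `ker π` is central (Schur's lemma for the irreducible unitary `ρ_ψ`) -/

section Model

variable {S : Type} [NormedAddCommGroup S] [InnerProductSpace ℂ S] [CompleteSpace S]
variable (ρ : Representation ℂ (AdelicHeisenberg F E V Φ) S)

/-- **a pair over `1` has scalar operator**: if `p = (1, M) ∈ Mp_𝐀(W)` (so `M` is a bounded automorphism of the
space of `ρ_ψ` commuting with every `ρ_ψ(h)`) and `ρ_ψ` is unitary and (topologically) irreducible, then
`M = c · id` — Schur's lemma. [cite: DeitmarEchterhoff2014, Thm. 5.1.6; GelbartRogawski1991, §3.1 p. 454 L21–27] -/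
theorem exists_op_eq_smul_of_proj_eq_one (hρu : ∀ (h : AdelicHeisenberg F E V Φ) (f : S), ‖ρ h f‖ = ‖f‖)
    (hρi : ∀ K : Submodule ℂ S, IsClosed (K : Set S) →
      (∀ (h : AdelicHeisenberg F E V Φ), ∀ f ∈ K, ρ h f ∈ K) → K = ⊥ ∨ K = ⊤)
    (p : adelicMp F E V Φ ρ) (hp : proj F E V Φ ρ p = 1) :
    ∃ c : ℂ, ∀ f : S, op F E V Φ ρ p f = c • f := by
  -- the operator `M = op p`, bounded by membership in `adelicMp`
  have hbd : Continuous (op F E V Φ ρ p) ∧ Continuous (op F E V Φ ρ p).symm := p.2.2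
  -- it commutes with every `ρ h` (condition (A) at `g = 1`)
  have hA : Implements ρ (ofSymplectic _ ((p : adelicSp F E V Φ × (S ≃ₗ[ℂ] S)).1))
      (p : adelicSp F E V Φ × (S ≃ₗ[ℂ] S)).2 := (mem_MpPsi ρ _).1 p.2.1
  have h1 : (p : adelicSp F E V Φ × (S ≃ₗ[ℂ] S)).1 = 1 := hp
  have hcomm : ∀ (h : AdelicHeisenberg F E V Φ) (f : S), op F E V Φ ρ p (ρ h f) = ρ h (op F E V Φ ρ p f) := by
    intro h f
    have := hA h f
    rw [h1, map_one, Heisenberg.PseudoSymplectic.act_one] at this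
    exact this
  -- `ρ h` as a linear isometry equivalence, and as a bounded operator
  have hinv : ∀ h : AdelicHeisenberg F E V Φ, (ρ h).comp (ρ h⁻¹) = LinearMap.id := fun h => by
    rw [← Module.End.mul_eq_comp, ← map_mul, mul_inv_cancel, map_one, Module.End.one_eq_id]
  have hinv' : ∀ h : AdelicHeisenberg F E V Φ, (ρ h⁻¹).comp (ρ h) = LinearMap.id := fun h => by
    rw [← Module.End.mul_eq_comp, ← map_mul, inv_mul_cancel, map_one, Module.End.one_eq_id]
  let U : AdelicHeisenberg F E V Φ → (S ≃ₗᵢ[ℂ] S) := fun h =>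
    { toLinearEquiv := LinearEquiv.ofLinear (ρ h) (ρ h⁻¹) (hinv h) (hinv' h)
      norm_map' := hρu h }
  have hU : ∀ (h : AdelicHeisenberg F E V Φ) (f : S), ((U h : S ≃ₗᵢ[ℂ] S) : S →L[ℂ] S) f = ρ h f := fun _ _ => rfl
  have hUsymm : ∀ (h : AdelicHeisenberg F E V Φ) (f : S), (U h).symm f = ρ h⁻¹ f := fun _ _ => rfl
  -- the bounded operator `T = M`
  let T : S →L[ℂ] S := ⟨(op F E V Φ ρ p : S →ₗ[ℂ] S), hbd.1⟩
  have hT : ∀ f : S, T f = op F E V Φ ρ p f := fun _ => rfl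
  -- the self-adjoint irreducible family `{ρ h}`
  let 𝒮 : Set (S →L[ℂ] S) := Set.range fun h => ((U h : S ≃ₗᵢ[ℂ] S) : S →L[ℂ] S)
  have h𝒮 : IsIrreducibleFamily 𝒮 := by
    intro W hWc hW
    exact hρi W hWc fun h f hf => (hU h f) ▸ hW _ ⟨h, rfl⟩ f hf
  have hstar : ∀ A ∈ 𝒮, ContinuousLinearMap.adjoint A ∈ 𝒮 := by
    rintro A ⟨h, rfl⟩
    refine ⟨h⁻¹, ContinuousLinearMap.ext fun f => ?_⟩
    rw [LinearIsometryEquiv.adjoint_eq_symm]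
    change ((U h⁻¹ : S ≃ₗᵢ[ℂ] S) : S →L[ℂ] S) f = (U h).symm f
    rw [hU, hUsymm]
  have hTc : ∀ A ∈ 𝒮, Commute A T := by
    rintro A ⟨h, rfl⟩
    refine ContinuousLinearMap.ext fun f => ?_
    change ((U h : S ≃ₗᵢ[ℂ] S) : S →L[ℂ] S) (T f) = T (((U h : S ≃ₗᵢ[ℂ] S) : S →L[ℂ] S) f)
    rw [hU, hU, hT, hT, hcomm]
  obtain ⟨c, hc⟩ := h𝒮.exists_eq_algebraMap hstar hTc
  refine ⟨c, fun f => ?_⟩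
  rw [← hT, hc, ContinuousLinearMap.algebraMap_apply]

/-- **middle exactness of the printed "`0 ⟶ ℂ* ⟶ Mp_𝐀(W) ⟶π Sp_𝐀(W) ⟶ 0`"** (p. 454 L26–27) for the printed
model: a pair `p ∈ Mp_𝐀(W)` lies over `1` iff it is `(1, c · id)` for a (unique) `c ∈ ℂˣ` — the operator is a scalar
by Schur, non-zero because it is invertible (on the zero space every pair over `1` is `(1, id)`).
[cite: GelbartRogawski1991, §3.1 p. 454 L21–27; MoeglinVignerasWaldspurger1987, Chap. 2 II.1 (B)] -/
theorem exists_eq_one_scalarOp_of_proj_eq_one (hρu : ∀ (h : AdelicHeisenberg F E V Φ) (f : S), ‖ρ h f‖ = ‖f‖)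
    (hρi : ∀ K : Submodule ℂ S, IsClosed (K : Set S) →
      (∀ (h : AdelicHeisenberg F E V Φ), ∀ f ∈ K, ρ h f ∈ K) → K = ⊥ ∨ K = ⊤)
    (p : adelicMp F E V Φ ρ) (hp : proj F E V Φ ρ p = 1) :
    ∃ c : ℂˣ, (p : adelicSp F E V Φ × (S ≃ₗ[ℂ] S)) = (1, scalarOp c) := by
  obtain ⟨c, hc⟩ := exists_op_eq_smul_of_proj_eq_one F E V Φ ρ hρu hρi p hp
  have h1 : (p : adelicSp F E V Φ × (S ≃ₗ[ℂ] S)).1 = 1 := hp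
  by_cases hS : ∃ f : S, f ≠ 0
  · obtain ⟨f₀, hf₀⟩ := hS
    have hc0 : c ≠ 0 := by
      intro hc0
      apply hf₀
      apply (op F E V Φ ρ p).injective
      rw [hc, hc0, zero_smul, map_zero]
    refine ⟨Units.mk0 c hc0, Prod.ext h1 (LinearEquiv.ext fun f => ?_)⟩
    change op F E V Φ ρ p f = scalarOp (Units.mk0 c hc0) f
    rw [hc, scalarOp_apply, Units.val_mk0]
  · refine ⟨1, Prod.ext h1 (LinearEquiv.ext fun f => ?_)⟩
    have hf : f = 0 := not_not.1 fun h => hS ⟨f, h⟩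
    change op F E V Φ ρ p f = scalarOp 1 f
    rw [hf, map_zero, map_zero]

omit [CompleteSpace S] in
/-- … and conversely every `(1, c · id)`, `c ∈ ℂˣ`, is a pair of `Mp_𝐀(W)` over `1` (bounded scalar operators
implement the identity). [cite: GelbartRogawski1991, §3.1 p. 454 L21–27; MoeglinVignerasWaldspurger1987, Chap. 2 II.1 (B)] -/
theorem one_scalarOp_mem_adelicMp (c : ℂˣ) : ((1 : adelicSp F E V Φ), scalarOp (S := S) c) ∈ adelicMp F E V Φ ρ :=
  ⟨one_scalarOp_mem_MpPsi ρ c, ⟨continuous_const_smul (c : ℂ), continuous_const_smul ((c⁻¹ : ℂˣ) : ℂ)⟩⟩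

/-- **a pair over `1` is central in `Mp_𝐀(W)`** (irreducible unitary `ρ_ψ`): its operator is a scalar, which commutes
with every (linear) `M_g`. [cite: GelbartRogawski1991, §3.1 p. 454 L21–27; MoeglinVignerasWaldspurger1987, Chap. 2 II.1 (B)] -/
theorem mem_center_of_proj_eq_one (hρu : ∀ (h : AdelicHeisenberg F E V Φ) (f : S), ‖ρ h f‖ = ‖f‖)
    (hρi : ∀ K : Submodule ℂ S, IsClosed (K : Set S) →
      (∀ (h : AdelicHeisenberg F E V Φ), ∀ f ∈ K, ρ h f ∈ K) → K = ⊥ ∨ K = ⊤)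
    (p : adelicMp F E V Φ ρ) (hp : proj F E V Φ ρ p = 1) : p ∈ Subgroup.center (adelicMp F E V Φ ρ) := by
  obtain ⟨c, hc⟩ := exists_op_eq_smul_of_proj_eq_one F E V Φ ρ hρu hρi p hp
  have h1 : (p : adelicSp F E V Φ × (S ≃ₗ[ℂ] S)).1 = 1 := hp
  rw [Subgroup.mem_center_iff]
  intro q
  apply Subtype.ext
  refine Prod.ext ?_ (LinearEquiv.ext fun f => ?_)
  · rw [Subgroup.coe_mul, Subgroup.coe_mul, Prod.fst_mul, Prod.fst_mul, h1, mul_one, one_mul]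
  · rw [Subgroup.coe_mul, Subgroup.coe_mul, Prod.snd_mul, Prod.snd_mul, LinearEquiv.mul_apply,
      LinearEquiv.mul_apply]
    change (q : adelicSp F E V Φ × (S ≃ₗ[ℂ] S)).2 (op F E V Φ ρ p f) =
      op F E V Φ ρ p ((q : adelicSp F E V Φ × (S ≃ₗ[ℂ] S)).2 f)
    rw [hc, hc, map_smul]

/-- **`ker π ≤ center Mp_𝐀(W)`** for the printed metaplectic group over an irreducible unitary `ρ_ψ` — the middle
exactness of "`0 ⟶ ℂ* ⟶ Mp_𝐀(W) ⟶π Sp_𝐀(W) ⟶ 0`" in the form needed for uniqueness of splittings.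
[cite: GelbartRogawski1991, §3.1 p. 454 L21–27; MoeglinVignerasWaldspurger1987, Chap. 2 II.1 (B)] -/
theorem ker_proj_le_center (hρu : ∀ (h : AdelicHeisenberg F E V Φ) (f : S), ‖ρ h f‖ = ‖f‖)
    (hρi : ∀ K : Submodule ℂ S, IsClosed (K : Set S) →
      (∀ (h : AdelicHeisenberg F E V Φ), ∀ f ∈ K, ρ h f ∈ K) → K = ⊥ ∨ K = ⊤) :
    (proj F E V Φ ρ).ker ≤ Subgroup.center (adelicMp F E V Φ ρ) := fun p hp =>
  mem_center_of_proj_eq_one F E V Φ ρ hρu hρi p ((MonoidHom.mem_ker).1 hp)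

/-! ## §3 "`π` splits UNIQUELY over `Sp_F(W)`" in the printed setting -/

omit [CompleteSpace S] in
/-- two rational splittings lie over the same map to `Sp_𝐀(W)`. [cite: GelbartRogawski1991, §3.1 p. 454 L35–36] -/
theorem proj_eq_of_isRationalSplitting {i i' : ratSp F E V Φ →* adelicMp F E V Φ ρ}
    (hi : IsRationalSplitting F E V Φ ρ i) (hi' : IsRationalSplitting F E V Φ ρ i') (g : ratSp F E V Φ) :
    proj F E V Φ ρ (i g) = proj F E V Φ ρ (i' g) :=
  Subtype.ext (LinearEquiv.toLinearMap_injective ((hi g).trans (hi' g).symm))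

/-- **[GR91 p. 454 L35–36] "`π` splits uniquely over `Sp_F(W)`" — KERNEL THEOREM in the printed setting**: for a
skew-Hermitian space `(V, Φ)` over the quadratic `E/F` with conjugation `σ` (`Φ y x = -σ(Φ x y)`), `φ = Tr_{E/F} Φ`
non-degenerate, `W = V|_F` finite-dimensional, and the group `Mp_𝐀(W)` of pairs over an irreducible unitary `ρ_ψ`
on a Hilbert space, ANY two homomorphisms `i i′ : Sp_F(W) →* Mp_𝐀(W)` that split `π` over `Sp_F(W) ⊆ Sp_𝐀(W)`
coincide.  Consequently the binder `_hi!` ("`i` is the unique splitting") of the statement-exact typing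
`Prop311AsPrinted` follows from its binder `_hi`.  (Perfectness of `Sp_F(W)` + `ker π` central.)
[cite: GelbartRogawski1991, §3.1 p. 454 L35–36; MoeglinVignerasWaldspurger1987, Chap. 2 II.1 (B)] -/
theorem rationalSplitting_unique [FiniteDimensional F V] (σ : E ≃ₐ[F] E)
    (hΦ₃ : ∀ x y : V, Φ y x = -σ (Φ x y)) (hφ : (traceForm F E V Φ).Nondegenerate)
    (hρu : ∀ (h : AdelicHeisenberg F E V Φ) (f : S), ‖ρ h f‖ = ‖f‖)
    (hρi : ∀ K : Submodule ℂ S, IsClosed (K : Set S) →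
      (∀ (h : AdelicHeisenberg F E V Φ), ∀ f ∈ K, ρ h f ∈ K) → K = ⊥ ∨ K = ⊤)
    (i i' : ratSp F E V Φ →* adelicMp F E V Φ ρ)
    (hi : IsRationalSplitting F E V Φ ρ i) (hi' : IsRationalSplitting F E V Φ ρ i') : i' = i :=
  Heisenberg.PseudoSymplectic.eq_of_comp_eq_of_ker_le_center (traceForm F E V Φ) (isAlt_traceForm F E V Φ σ hΦ₃)
    hφ (proj F E V Φ ρ) (ker_proj_le_center F E V Φ ρ hρu hρi) i' i
    fun g => (proj_eq_of_isRationalSplitting F E V Φ ρ hi hi' g).symm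

/-- the binder shape of `Prop311AsPrinted`: given `_hi : IsRationalSplitting i`, the clause
`_hi! : ∀ i′, IsRationalSplitting i′ → i′ = i` HOLDS. [cite: GelbartRogawski1991, §3.1 p. 454 L35–36] -/
theorem forall_isRationalSplitting_eq [FiniteDimensional F V] (σ : E ≃ₐ[F] E)
    (hΦ₃ : ∀ x y : V, Φ y x = -σ (Φ x y)) (hφ : (traceForm F E V Φ).Nondegenerate)
    (hρu : ∀ (h : AdelicHeisenberg F E V Φ) (f : S), ‖ρ h f‖ = ‖f‖)
    (hρi : ∀ K : Submodule ℂ S, IsClosed (K : Set S) →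
      (∀ (h : AdelicHeisenberg F E V Φ), ∀ f ∈ K, ρ h f ∈ K) → K = ⊥ ∨ K = ⊤)
    (i : ratSp F E V Φ →* adelicMp F E V Φ ρ) (hi : IsRationalSplitting F E V Φ ρ i) :
    ∀ i' : ratSp F E V Φ →* adelicMp F E V Φ ρ, IsRationalSplitting F E V Φ ρ i' → i' = i :=
  fun i' hi' => rationalSplitting_unique F E V Φ ρ σ hΦ₃ hφ hρu hρi i i' hi hi'

/-- the same with the finiteness hypothesis in the printed form (`V` finite-dimensional over the quadratic
extension `E` of `F`). [cite: GelbartRogawski1991, §3.1 p. 454 L35–42] -/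
theorem rationalSplitting_unique' [Module E V] [IsScalarTower F E V] [Algebra.IsQuadraticExtension F E]
    [FiniteDimensional E V] (σ : E ≃ₐ[F] E)
    (hΦ₃ : ∀ x y : V, Φ y x = -σ (Φ x y)) (hφ : (traceForm F E V Φ).Nondegenerate)
    (hρu : ∀ (h : AdelicHeisenberg F E V Φ) (f : S), ‖ρ h f‖ = ‖f‖)
    (hρi : ∀ K : Submodule ℂ S, IsClosed (K : Set S) →
      (∀ (h : AdelicHeisenberg F E V Φ), ∀ f ∈ K, ρ h f ∈ K) → K = ⊥ ∨ K = ⊤)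
    (i i' : ratSp F E V Φ →* adelicMp F E V Φ ρ)
    (hi : IsRationalSplitting F E V Φ ρ i) (hi' : IsRationalSplitting F E V Φ ρ i') : i' = i :=
  haveI : FiniteDimensional F V := finite_restrictScalars F E V
  rationalSplitting_unique F E V Φ ρ σ hΦ₃ hφ hρu hρi i i' hi hi'

/-- **existence ⇒ unique existence**: in the printed setting, if `π` splits over `Sp_F(W)` at all then the splitting
is unique (`∃ i, IsRationalSplitting i → ∃! i, IsRationalSplitting i`). [cite: GelbartRogawski1991, §3.1 p. 454 L35–36] -/
theorem existsUnique_of_exists_isRationalSplitting [FiniteDimensional F V] (σ : E ≃ₐ[F] E)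
    (hΦ₃ : ∀ x y : V, Φ y x = -σ (Φ x y)) (hφ : (traceForm F E V Φ).Nondegenerate)
    (hρu : ∀ (h : AdelicHeisenberg F E V Φ) (f : S), ‖ρ h f‖ = ‖f‖)
    (hρi : ∀ K : Submodule ℂ S, IsClosed (K : Set S) →
      (∀ (h : AdelicHeisenberg F E V Φ), ∀ f ∈ K, ρ h f ∈ K) → K = ⊥ ∨ K = ⊤)
    (hex : ∃ i : ratSp F E V Φ →* adelicMp F E V Φ ρ, IsRationalSplitting F E V Φ ρ i) :
    ∃! i : ratSp F E V Φ →* adelicMp F E V Φ ρ, IsRationalSplitting F E V Φ ρ i :=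
  hex.elim fun i hi => ⟨i, hi, fun i' hi' => rationalSplitting_unique F E V Φ ρ σ hΦ₃ hφ hρu hρi i i' hi hi'⟩

end Model

end Prop311

end Literature.NumberTheory.GelbartRogawski1991

end
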